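import Summits.ResolutionOfSingularities.ResolutionOfSingularities.Theorems.MarkedTransferCampaignW46WWalkThread
import Summits.ResolutionOfSingularities.ResolutionOfSingularities.Theorems.MarkedTransferCampaignW46WWalkCombinatorics
import Summits.ResolutionOfSingularities.ResolutionOfSingularities.Theorems.MarkedTransferCampaignW46WWalkEndgame
import Summits.ResolutionOfSingularities.ResolutionOfSingularities.Theorems.MarkedTransferCampaignW46MohWindowShadeFormalTerminates
import HarnessLib

/-!
# [OURS · L1 W4.6 rung (iii-2)] THE W-WALK CLOSES ON THE DOOR: no hit thread with a `w`-anchored root inside o1's regime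
# `regimeMohWindowSurfaceInsep` (purely inseparable surface Moh window, NON-PI residuals included)

Cell `res-hironaka`, LADDER-RESOLUTION rung L (D-0089), slot W4.6 rung (iii); seat res-L1-s46-pv-5 (gen 6), plan
`HOME/L/res-L1-s46-pv-5/W-WALK-PLAN.md` §2/§5 (F5). Host route MarkedTransfer, `--supports stmt-ResolutionOfSingularities-16155 --as helper`;
kind proof (def-free). Template (recursion and hit-stage extraction copied): res-L1-s46-pv-6 `…FormalInsepWalk.false_of_hitThread_formalInsepAnchor`.

WHAT. `false_of_hitThread_wAnchor`: an infinite §2.1-permissible sequence inside `regimeMohWindowSurfaceInsep` with a hit thread whose points are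
residually rational over their images and whose root carries a `w`-anchor `e(f₀) = w · (z^p + f)` with `ord f ≥ p + 1` does not exist. The thread
carries the W-walk (`…WWalkThread.wAnchor_succ`); its hit stages form an infinite model walk satisfying the hypotheses of
`…WWalkCombinatorics.eventually_tStep` (window and (ND) from `…WWalkThread.residual_facts`, boundary exponents `< p` from the door,
`…WWalkThread.bdiv_lt_of_wAnchor`), so from some hit on every step is a `T`-step; the `T`-tail contradicts the door through
`…WWalkEndgame.false_of_tTail` (`…WWalkEndgame.subst_stepS_generator`).

HONEST FRAMING. OURS; nothing here is a statement of H. Hironaka's manuscript [Hironaka2017] and nothing of it is used. AI-written;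
AI review is weaker than expert review. No `sorry`; axioms standard. [cite: StacksProject, Tag 0804] [cite: Hauser2010, §§F–G]
-/

noncomputable section

set_option linter.dupNamespace false -- mandated namespace of this single-conjunct summit

open MvPowerSeries IsLocalRing Finset
open Literature.AlgebraicGeometry.Resolution
open Literature.RingTheory.MvPowerSeries.Jets (mem_maximalIdeal_iff_constantCoeff_eq_zero mem_maximalIdeal_pow_iff)

namespace Summit.ResolutionOfSingularities.ResolutionOfSingularities.Theorems

namespace CampaignW46

namespace WWalk

open CategoryTheory AlgebraicGeometry TopologicalSpace
open Literature.AlgebraicGeometry.Hironaka2017.S02Preliminaries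
open Literature.AlgebraicGeometry.Hironaka2017.Datum
open Scheme.IdealSheafData

variable {p : ℕ} [hp : Fact p.Prime] {K : Type} [Field K] [CharP K p] [PerfectField K] [DecidableEq K]

/-- **THE W-WALK CLOSES ON THE DOOR.** See the module docstring. [cite: StacksProject, Tag 0804] [cite: Hauser2010, §§F–G] -/
theorem false_of_hitThread_wAnchor (r : PermissibleRun p K)
    (hr : ∀ k, regimeMohWindowSurfaceInsep (p := p) (K := K) (r.A k) (r.E k)) (t : r.HitThread)
    (hrat : ∀ k (y : (r.A (k + 1)).Z.presheaf.stalk (t.y (k + 1))), ∃ x : (r.A k).Z.presheaf.stalk ((r.π k).base (t.y (k + 1))),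
      y - ((r.π k).stalkMap (t.y (k + 1))).hom x ∈ maximalIdeal _)
    (fR : MvPowerSeries (Option (Fin 2)) K) (hfR : LowVanish (p + 1) fR)
    (hA0 : ∃ (e : AdicCompletion (maximalIdeal ((r.A 0).Z.presheaf.stalk (t.y 0))) ((r.A 0).Z.presheaf.stalk (t.y 0)) ≃+*
        MvPowerSeries (Option (Fin 2)) K) (f₀ : (r.A 0).Z.presheaf.stalk (t.y 0)) (w : MvPowerSeries (Option (Fin 2)) K),
      stalkIdeal (r.E 0).J (t.y 0) = Ideal.span {f₀} ∧ IsUnit w ∧ e (algebraMap _ _ f₀) = w * (X none ^ p + fR)) :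
    False := by
  classical
  have hp2 : 2 ≤ p := hp.out.two_le
  -- the anchor predicate at stage `k` for a model state `(f, r_t, r_y)`
  let St := MvPowerSeries (Option (Fin 2)) K × ℕ × ℕ
  let Anch : ℕ → St → Prop := fun k s =>
    (∃ (e : AdicCompletion (maximalIdeal ((r.A k).Z.presheaf.stalk (t.y k))) ((r.A k).Z.presheaf.stalk (t.y k)) ≃+*
        MvPowerSeries (Option (Fin 2)) K) (f₀ : (r.A k).Z.presheaf.stalk (t.y k)) (w : MvPowerSeries (Option (Fin 2)) K),
      stalkIdeal (r.E k).J (t.y k) = Ideal.span {f₀} ∧ IsUnit w ∧ e (algebraMap _ _ f₀) = w * (X none ^ p + s.1)) ∧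
    LowVanish (p + 1) s.1 ∧ BDiv s.2.1 s.2.2 s.1
  -- one step, by `wAnchor_succ`
  have G : ∀ (k : ℕ) (P : {s : St // Anch k s}), ∃ (Q : {s : St // Anch (k + 1) s}) (v : Bool) (l γ : K),
      ((r.D k : Set (r.A k).Z) = {t.y k} →
        (v = false → Q.1.1 = stepT p l γ P.1.1 ∧ Q.1.2.1 = P.1.1.order.toNat - p ∧ Q.1.2.2 = (if l = 0 then P.1.2.2 else 0) ∧
          (l = 0 → 0 < P.1.2.2 → γ = 0)) ∧
        (v = true → Q.1.1 = stepT p 0 γ (swapTY P.1.1) ∧ Q.1.2.1 = P.1.1.order.toNat - p ∧ Q.1.2.2 = P.1.2.1 ∧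
          (0 < P.1.2.1 → γ = 0))) ∧
      ((r.D k : Set (r.A k).Z) ≠ {t.y k} → Q.1 = P.1) := by
    intro k P
    obtain ⟨hA, hP2, hB⟩ := P.2
    obtain ⟨f', rt', ry', v, l, γ, h1, h2, hA', hP2', hB'⟩ := wAnchor_succ r hr t k (hrat k) P.1.1 P.1.2.1 P.1.2.2 hA hP2 hB
    refine ⟨⟨(f', rt', ry'), hA', hP2', hB'⟩, v, l, γ, h1, fun h => ?_⟩
    obtain ⟨e1, e2, e3⟩ := h2 h
    change (f', rt', ry') = P.1
    rw [e1, e2, e3]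
  choose next nv nl nγ hnext using G
  let seq : ∀ k, {s : St // Anch k s} :=
    fun k => Nat.rec (motive := fun k => {s : St // Anch k s}) ⟨(fR, 0, 0), hA0, hfR, fun _ _ => ⟨Nat.zero_le _, Nat.zero_le _⟩⟩
      (fun k P => next k P) k
  have hseq : ∀ k, seq (k + 1) = next k (seq k) := fun k => rfl
  -- the hit stages
  set P : ℕ → Prop := fun k => (r.D k : Set (r.A k).Z) = {t.y k} with hP
  have hinf : (setOf P).Infinite :=
    Nat.frequently_atTop_iff_infinite.mp (Filter.frequently_atTop.mpr fun a => t.hit a)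
  have hPnth : ∀ n, P (Nat.nth P n) := Nat.nth_mem_of_infinite hinf
  have hgap : ∀ n m, Nat.nth P n < m → m < Nat.nth P (n + 1) → ¬ P m := by
    intro n m h1 h2 hm
    obtain ⟨i, -, hi⟩ := Nat.exists_lt_card_nth_eq hm
    rw [← hi] at h1 h2
    have := (Nat.nth_lt_nth hinf).mp h1
    have := (Nat.nth_lt_nth hinf).mp h2
    omega
  -- the state is constant off the hit stages
  have hstay : ∀ m, ¬ P m → (seq (m + 1)).1 = (seq m).1 := fun m hm => by
    rw [hseq]; exact (hnext m (seq m)).2 hm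
  have hconst : ∀ n d, Nat.nth P n + 1 + d ≤ Nat.nth P (n + 1) →
      (seq (Nat.nth P n + 1 + d)).1 = (seq (Nat.nth P n + 1)).1 := by
    intro n d
    induction d with
    | zero => intro _; rfl
    | succ d ih =>
      intro hle
      have h1 : (seq (Nat.nth P n + 1 + d + 1)).1 = (seq (Nat.nth P n + 1 + d)).1 :=
        hstay _ (hgap n _ (by omega) (by omega))
      rw [← ih (by omega), ← h1]
      rfl
  -- the model walk, indexed by the hits
  set fM : ℕ → MvPowerSeries (Option (Fin 2)) K := fun n => (seq (Nat.nth P n)).1.1 with hfM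
  set rtM : ℕ → ℕ := fun n => (seq (Nat.nth P n)).1.2.1 with hrtM
  set ryM : ℕ → ℕ := fun n => (seq (Nat.nth P n)).1.2.2 with hryM
  set vM : ℕ → Bool := fun n => nv (Nat.nth P n) (seq (Nat.nth P n)) with hvM
  set lM : ℕ → K := fun n => nl (Nat.nth P n) (seq (Nat.nth P n)) with hlM
  set γM : ℕ → K := fun n => nγ (Nat.nth P n) (seq (Nat.nth P n)) with hγM
  have hnextM : ∀ n, (seq (Nat.nth P (n + 1))).1 = (seq (Nat.nth P n + 1)).1 := by
    intro n
    have hlt : Nat.nth P n < Nat.nth P (n + 1) := (Nat.nth_lt_nth hinf).mpr (Nat.lt_succ_self n)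
    obtain ⟨d, hd⟩ : ∃ d, Nat.nth P (n + 1) = Nat.nth P n + 1 + d := ⟨Nat.nth P (n + 1) - (Nat.nth P n + 1), by omega⟩
    rw [hd]
    exact hconst n d (by omega)
  have hhitrel : ∀ n,
      (vM n = false → fM (n + 1) = stepT p (lM n) (γM n) (fM n) ∧ rtM (n + 1) = (fM n).order.toNat - p ∧
        ryM (n + 1) = (if lM n = 0 then ryM n else 0) ∧ (lM n = 0 → 0 < ryM n → γM n = 0)) ∧
      (vM n = true → fM (n + 1) = stepT p 0 (γM n) (swapTY (fM n)) ∧ rtM (n + 1) = (fM n).order.toNat - p ∧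
        ryM (n + 1) = rtM n ∧ (0 < rtM n → γM n = 0)) := by
    intro n
    have h := (hnext (Nat.nth P n) (seq (Nat.nth P n))).1 (hPnth n)
    rw [← hseq] at h
    simp only [hfM, hrtM, hryM, hvM, hlM, hγM, hnextM n]
    exact h
  -- per-hit facts from the regime at the hit stage
  have hfacts : ∀ n, ∃ d : ℕ, (fM n).order = d ∧ p + 1 ≤ d ∧ d ≤ 2 * p - 1 ∧ LowVanish d (fM n) ∧
      (∃ a b c, a + b + c = d ∧ coeff (mk3 a b c) (fM n) ≠ 0) ∧ (d - rtM n - ryM n < p → NDz d (fM n)) := by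
    intro n
    obtain ⟨⟨e, f₀, w, hJ, hw, hE⟩, hP2, hB⟩ := (seq (Nat.nth P n)).2
    exact residual_facts (hr _) (t.mem _) e hJ hw hE hP2 hB
  choose dM hdM using hfacts
  have hdto : ∀ n, (fM n).order.toNat = dM n := fun n => by rw [(hdM n).1]; rfl
  have hiso : ∀ n, rtM n < p ∧ ryM n < p := by
    intro n
    obtain ⟨⟨e, f₀, w, hJ, -, hE⟩, -, hB⟩ := (seq (Nat.nth P n)).2
    exact bdiv_lt_of_wAnchor (hr _) e hJ hE hB
  -- the combinatorial termination: a `T`-tail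
  obtain ⟨N, hN⟩ := eventually_tStep hp2 fM rtM ryM dM vM lM γM (fun n => (seq (Nat.nth P n)).2.2.2) (fun n => (hdM n).2.2.2.1)
    (fun n => (hdM n).2.2.2.2.1) (fun n => ⟨(hdM n).2.1, (hdM n).2.2.1⟩) hiso
    (fun n hv => by have h := (hhitrel n).1 hv; rw [hdto] at h; exact h)
    (fun n hv => by have h := (hhitrel n).2 hv; rw [hdto] at h; exact h)
    (fun n => (hdM n).2.2.2.2.2)
  -- the `T`-tail contradicts the door at the `N`-th hit
  haveI : CharP (MvPowerSeries (Option (Fin 2)) K) p := charP_of_injective_ringHom (MvPowerSeries.C_injective) p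
  refine false_of_tTail (p := p) (fun k => X none ^ p + fM (N + k)) (fun k => lM (N + k)) (fun k => γM (N + k)) (fun k => ?_)
    (fun k => ?_) ?_
  · -- the step relation
    have hv : vM (N + k) = false := hN _ (by omega)
    have h := ((hhitrel (N + k)).1 hv).1
    rw [show N + (k + 1) = N + k + 1 by omega, h]
    exact (subst_stepS_generator (lM (N + k)) (γM (N + k)) (f := fM (N + k))
      (fun e he => (seq (Nat.nth P (N + k))).2.2.1 e (by omega))).symm
  · -- order `≥ p`
    intro e he
    rw [map_add, (seq (Nat.nth P (N + k))).2.2.1 e (by omega), add_zero, X_pow_eq, coeff_monomial, if_neg]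
    intro h
    rw [h, Finsupp.degree_single] at he
    exact lt_irrefl _ he
  · -- the door at the `N`-th hit
    obtain ⟨⟨e, f₀, w, hJ, hw, hE⟩, -, -⟩ := (seq (Nat.nth P N)).2
    obtain ⟨⟨⟨-, hcl⟩, -⟩, hb⟩ := (regimeMohWindowSurfaceInsep_iff _ _).mp (hr (Nat.nth P N))
    obtain ⟨N₀, hN₀⟩ := exists_forall_not_map_le_span_pair_pow_sup_mvPowerSeries (r.A _) (r.E _) hcl (by rw [hb]; exact hp.out.pos)
      (t.y _) e
    rw [hb] at hN₀
    refine ⟨N₀, fun u v hu hv hmem => hN₀ u v hu hv ?_⟩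
    rw [hJ, Ideal.map_span, Set.image_singleton, RingHom.comp_apply]
    change Ideal.span {e (algebraMap _ _ f₀)} ≤ _
    rw [hE, Ideal.span_singleton_le_iff_mem]
    exact Ideal.mul_mem_left _ _ hmem

/-! ## The root anchor and the rung over an algebraically closed field -/

omit [PerfectField K] [DecidableEq K] in
/-- **THE ROOT `w`-ANCHOR from o1's regime** at a closed singular point over an algebraically closed field: Cohen coordinates adapted to
the regime's own `(x, y, z)` (`…MohWindowShadeFormalTerminates.exists_cohen_anchor_option` through the constants `germConst`) turn the
generator `z^p + Σ a_i x^{d−i} y^i` into `z^p + f` with `ord f ≥ d ≥ p + 1` — no cleaning needed at the root. [cite: Matsumura1987, Thm. 29.7] -/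
theorem exists_wAnchor_start [IsAlgClosed K] {A : AmbientDatum p K} {E : IdealExponent A.Z}
    (hRg : regimeMohWindowSurfaceInsep (p := p) (K := K) A E) {ξ : A.Z} (hξ : ξ ∈ E.sing) :
    ∃ (e : AdicCompletion (maximalIdeal (A.Z.presheaf.stalk ξ)) (A.Z.presheaf.stalk ξ) ≃+* MvPowerSeries (Option (Fin 2)) K)
      (f₀ : A.Z.presheaf.stalk ξ) (w f : MvPowerSeries (Option (Fin 2)) K),
      stalkIdeal E.J ξ = Ideal.span {f₀} ∧ IsUnit w ∧ e (algebraMap _ _ f₀) = w * (X none ^ p + f) ∧ LowVanish (p + 1) f := by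
  classical
  obtain ⟨hR, h3, hcl, -, -⟩ := MohWindowShadeAnchorWalk.regime_point hRg hξ
  haveI := hR
  obtain ⟨-, -, x, y, z, hxyz, d, a, hbd, -, -, hI⟩ := coeffAt_of_regime hRg hξ
  obtain ⟨e, hEx, hEy, hEz, -⟩ := exists_cohen_anchor_option h3 hxyz (germConst A ξ)
    (MohWindowShadeAnchorWalk.exists_sub_germ_sectionConst_mem A hcl)
  set φ : A.Z.presheaf.stalk ξ →+* MvPowerSeries (Option (Fin 2)) K :=
    (e : _ →+* MvPowerSeries (Option (Fin 2)) K).comp (algebraMap _ (AdicCompletion (maximalIdeal (A.Z.presheaf.stalk ξ)) (A.Z.presheaf.stalk ξ))) with hφ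
  have hφa : ∀ r, φ r = e (algebraMap _ _ r) := fun r => rfl
  set f : MvPowerSeries (Option (Fin 2)) K := ∑ i ∈ range (d + 1), φ (a i) * X (some 0) ^ (d - i) * X (some 1) ^ i with hf
  refine ⟨e, z ^ p + ∑ i ∈ range (d + 1), a i * x ^ (d - i) * y ^ i, 1, f, hI, isUnit_one, ?_, ?_⟩
  · rw [one_mul, ← hφa, map_add, map_pow, hφa z, hEz, map_sum]
    congr 1
    refine sum_congr rfl fun i _ => ?_
    rw [map_mul, map_mul, map_pow, map_pow, hφa x, hEx, hφa y, hEy]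
  · -- `f ∈ 𝔪^d ⊆ 𝔪^{p+1}`
    refine mem_maximalIdeal_pow_iff.mp (Ideal.pow_le_pow_right (by omega : p + 1 ≤ d) (Ideal.sum_mem _ fun i hi => ?_))
    rw [mem_range] at hi
    rw [mul_assoc]
    refine Ideal.mul_mem_left _ _ ?_
    have h1 := Ideal.mul_mem_mul
      (Ideal.pow_mem_pow (mem_maximalIdeal_iff_constantCoeff_eq_zero.mpr (constantCoeff_X (some 0) : constantCoeff (X (some 0) : MvPowerSeries (Option (Fin 2)) K) = 0)) (d - i))
      (Ideal.pow_mem_pow (mem_maximalIdeal_iff_constantCoeff_eq_zero.mpr (constantCoeff_X (some 1) : constantCoeff (X (some 1) : MvPowerSeries (Option (Fin 2)) K) = 0)) i)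
    rwa [← pow_add, show d - i + i = d by omega] at h1

omit [PerfectField K] [DecidableEq K] in
/-- **RUNG (iii), PURELY INSEPARABLE SURFACE MOH WINDOW — o1's regime of record, NON-PI residuals included — over an algebraically closed
field, every characteristic `p`.** There is no infinite §2.1-permissible sequence inside `regimeMohWindowSurfaceInsep`: it would carry a hit
thread (res-L1-s46-pv-1), residually rational at closed points (Zariski), rooted at a `w`-anchored point (`exists_wAnchor_start`), against
`false_of_hitThread_wAnchor`. [OURS · L1 W4.6 rung (iii)] NOT a statement of the manuscript. [cite: StacksProject, Tag 0CY7] -/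
theorem mohWindowSurfaceInsepPermissiblyTerminates_of_isAlgClosed [IsAlgClosed K] : MohWindowSurfaceInsepPermissiblyTerminates p K := by
  classical
  intro r hr
  obtain ⟨t⟩ := r.nonempty_hitThread fun k => ((regimeMohWindowSurfaceInsep_iff _ _).mp (hr k)).1.1
  obtain ⟨e, f₀, w, f, hJ, hw, hE, hfP2⟩ := exists_wAnchor_start (hr 0) (t.mem 0)
  refine false_of_hitThread_wAnchor r hr t (fun k y => ?_) f hfP2 ⟨e, f₀, w, hJ, hw, hE⟩
  -- closed points over an algebraically closed field are rational over their images
  haveI : LocallyOfFiniteType (r.π k ≫ (r.A k).hom) := by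
    rw [← r.hom_eq k]
    haveI := (r.A (k + 1)).smooth
    infer_instance
  obtain ⟨-, -, hcl, -, -⟩ := MohWindowShadeAnchorWalk.regime_point (hr (k + 1)) (t.mem (k + 1))
  exact CampaignW46.ChartPoint.exists_sub_stalkMap_mem_maximalIdeal_of_isClosed (r.π k) (r.A k).hom (t.y (k + 1)) hcl y

end WWalk

end CampaignW46

end Summit.ResolutionOfSingularities.ResolutionOfSingularities.Theorems

end
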